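import Summits.HodgeConjecture.HodgeConjecture.Theorems.LinearSystemTorelliLocalTubeSpanUnimodularTransitivityLocalLemmas
import Summits.HodgeConjecture.HodgeConjecture.Theorems.LinearSystemTorelliLocalTubeSpanUnimodularTransitivity

/-!
# Route LinearSystemTorelli — crux `LocalTubeSpan` (stmt-HodgeConjecture-2490): unimodular transitivity of the level-2 elementary moves, LOCAL hypotheses

Helper file (`--supports stmt-HodgeConjecture-2490`, line `Sketch` of the crux chain, cycle 8,
worker D: local hypotheses; continuation lead c7; the lead's stub `stub_unimodularTransitivityLocal`;
lemmas in `…UnimodularTransitivityLocalLemmas`).  This is cycle 7's `…UnimodularTransitivity`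
re-proved with the move hypotheses required ONLY where its proof uses them: the pair moves
`E_{e,f}²` at `e ∈ {x, y}` and the squares `T_a²` at `a ∈ {x, y, x + y}`; the partner splitting
`localTubeSpan_partner_split` (no move hypotheses) is imported from `…UnimodularTransitivity`.

Let `Λ = ℤΔ` be a lattice in the `ℚ`-space `V` on which the alternating form `B` is integral, let
`x, y ∈ Λ` with `⟨x, y⟩ = 1`, and let `Γ ≤ GL(V)` contain the squared transvection pairs
`E_{e,f}² : v ↦ v + 2(⟨v,e⟩f + ⟨v,f⟩e)` for `e ∈ {x, y}`, `f ∈ Λ`, `⟨e, f⟩ = 0`, and the squares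
`T_a² : v ↦ v - 2⟨v,a⟩a` for `a ∈ {x, y, x + y}` — for the monodromy group `Γ_Δ` of a skew vanishing
lattice and a base pair `x, y ∈ Δ` these memberships are supplied in cycle 8 WITHOUT Janssen's
Theorem 2.5 (cycle 7's `localTubeSpan_unimodularTransitivity` assumed both families for ALL
`e, f, a ∈ Λ`, i.e. granted Theorem 2.5).  MAIN THEOREM `localTubeSpan_unimodularTransitivity_local`:
every UNIMODULAR `t ∈ x + 2Λ` (`⟨t, y'⟩ = 1` for some `y' ∈ Λ`) is `g x` for some `g ∈ Γ`.  This is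
the content of Janssen's Theorem 2.9 (`x ∈ Δ ↔ x` unimodular `∧ x ≡ δ mod 2Λ`), which thereby becomes
unconditional.

Proof (coordinates `A = ⟨t, y⟩`, odd, and `β = ⟨z, x⟩` for `t = x + 2z`):
* `(A, β) = (1, 0)`, `(-1, 0)`, coprime: `…UnimodularTransitivityLocalLemmas` (the move `E_{y,z}²`,
  the word `T_x² T_y² T_{x+y}²`, and the Euclid game with powers of `T_x²`, `T_y²`);
* `β ≠ 0`: a partner `y'` of `t` splits as `y' = ⟨y',y⟩x - ⟨y',x⟩y + w₁` with `w₁ ⟂ x, y` and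
  `-⟨y',x⟩A + 2⟨y',y⟩β + ⟨t, w₁⟩ = 1`; the move `E_{x, s w₁}²` shifts `A ↦ A + 2s⟨t, w₁⟩`, coprime to
  `β` for the `s` of `…CoprimeShift` (`localTubeSpan_reach_of_ne_zero_local`);
* `β = 0`, `A ≠ ±1`: one move `E_{y, w₁}²` makes `β = -⟨t, w₁⟩ ≠ 0`, unimodularity being transported
  along the isometry.

No named facts (the two move families are hypotheses); no `sorry`.
-/

-- `Summit.HodgeConjecture.HodgeConjecture.Theorems` is the mandated namespace (single-conjunct summit:
-- Sub = Summit), which `linter.dupNamespace` flags on every declaration; the lakefile turns the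
-- linter off tree-wide (weak option), restated here so stand-alone elaboration is warning-free too.

set_option linter.dupNamespace false

noncomputable section

open Literature.AlgebraicGeometry.HodgeTheory

namespace Summit.HodgeConjecture.HodgeConjecture.Theorems

variable {V : Type} [AddCommGroup V] [Module ℚ V]

section ReachLocal

variable (B : LinearMap.BilinForm ℚ V) (Δ : Set V) (Γ : Subgroup (V →ₗ[ℚ] V)ˣ) {x y : V}

/-- The case `β = ⟨z, x⟩ ≠ 0`: a unimodular `t = x + 2z` is reachable — break the common factor of
`(A, β)` by the pair move `E_{x, s w₁}²: A ↦ A + 2s⟨t, w₁⟩` at `e = x` (`s` from the coprime shift),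
then the coprime case. [folklore] -/
theorem localTubeSpan_reach_of_ne_zero_local (hB : B.IsAlt)
    (hint : ∀ δ ∈ Δ, ∀ δ' ∈ Δ, ∃ n : ℤ, B δ δ' = n) (hxy : B x y = 1)
    (hpair : ∀ e ∈ ({x, y} : Set V), ∀ f ∈ Submodule.span ℤ Δ, B e f = 0 →
      ∃ g ∈ Γ, ∀ v : V, ((g : (V →ₗ[ℚ] V)ˣ) : V →ₗ[ℚ] V) v = v + (2 : ℚ) • (B v e • f + B v f • e))
    (hsq : ∀ a ∈ ({x, y, x + y} : Set V), ∃ g ∈ Γ, ∀ v : V,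
      ((g : (V →ₗ[ℚ] V)ˣ) : V →ₗ[ℚ] V) v = v - (2 : ℚ) • (B v a • a))
    (hx : x ∈ Submodule.span ℤ Δ) (hy : y ∈ Submodule.span ℤ Δ)
    {t z : V} (hz : z ∈ Submodule.span ℤ Δ) (ht : t = x + (2 : ℚ) • z)
    {A β : ℤ} (htA : B t y = A) (hzβ : B z x = β) (hβ0 : β ≠ 0)
    (htu : ∃ y' ∈ Submodule.span ℤ Δ, B t y' = 1) :
    ∃ g ∈ Γ, ((g : (V →ₗ[ℚ] V)ˣ) : V →ₗ[ℚ] V) x = t := by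
  obtain ⟨y', hy', hty'⟩ := htu
  obtain ⟨w₁, hw₁, hw₁x, hw₁y, hrel⟩ := localTubeSpan_partner_split B Δ hxy hB hint hx hy hy' hty'
  have htmem : t ∈ Submodule.span ℤ Δ := by
    rw [ht, show (2 : ℚ) • z = ((2 : ℤ) : ℚ) • z by norm_num]
    exact Submodule.add_mem _ hx (localTubeSpan_intCast_smul_mem Δ hz _)
  have htx : B t x = 2 * β := by
    rw [ht, map_add, map_smul, LinearMap.add_apply, LinearMap.smul_apply, hB.self_eq_zero, hzβ,
      smul_eq_mul, zero_add]
  obtain ⟨u, hu⟩ := localTubeSpan_integral_span B Δ hint hy' hx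
  obtain ⟨w, hw⟩ := localTubeSpan_integral_span B Δ hint hy' hy
  obtain ⟨j, hj⟩ := localTubeSpan_integral_span B Δ hint htmem hw₁
  -- the arithmetic relation `(-u) A + 2 w β + j = 1`
  have hrelZ : -u * A + 2 * w * β + j = 1 := by
    rw [hu, hw, htA, htx, hj] at hrel
    exact_mod_cast (show -(u : ℚ) * A + 2 * w * β + j = 1 by rw [← hrel]; ring)
  -- `A` is odd
  have hAodd : Odd A := by
    obtain ⟨n, hn⟩ := localTubeSpan_integral_span B Δ hint hz hy
    have h : (A : ℚ) = 2 * n + 1 := by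
      rw [← htA, ht, map_add, map_smul, LinearMap.add_apply, LinearMap.smul_apply, hxy, hn,
        smul_eq_mul]
      ring
    exact ⟨n, by exact_mod_cast h⟩
  by_cases hj0 : j = 0
  · -- `j = 0`: `(A, β)` is already coprime
    refine localTubeSpan_reach_of_isCoprime_local B Δ Γ hB hint hxy hpair hsq hx hy hz ht htA hzβ
      ⟨-u, 2 * w, ?_⟩
    rw [hj0] at hrelZ
    linarith
  · obtain ⟨s, hs⟩ := localTubeSpan_coprimeShift A β j (-u) w hAodd hrelZ hβ0 hj0
    have hsw₁ : (s : ℚ) • w₁ ∈ Submodule.span ℤ Δ := localTubeSpan_intCast_smul_mem Δ hw₁ s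
    have hxsw₁ : B x ((s : ℚ) • w₁) = 0 := by
      rw [map_smul, smul_eq_mul, ← hB.neg_eq, hw₁x, neg_zero, mul_zero]
    obtain ⟨g, hg, hgf⟩ := hpair x (by simp) _ hsw₁ hxsw₁
    refine localTubeSpan_reach_of_reach_apply Γ hg ?_
    have htw₁ : B t ((s : ℚ) • w₁) = s * j := by rw [map_smul, smul_eq_mul, hj]
    refine localTubeSpan_reach_of_isCoprime_local B Δ Γ hB hint hxy hpair hsq hx hy
      (z := z + ((2 * β * s : ℤ) : ℚ) • w₁ + ((s * j : ℤ) : ℚ) • x)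
      (Submodule.add_mem _ (Submodule.add_mem _ hz (localTubeSpan_intCast_smul_mem Δ hw₁ _))
        (localTubeSpan_intCast_smul_mem Δ hx _)) ?_ (A := A + s * (2 * j)) (β := β) ?_ ?_ hs
    · rw [hgf, htx, htw₁, ht]
      push_cast
      module
    · rw [hgf, htx, htw₁]
      simp only [map_add, map_smul, LinearMap.add_apply, LinearMap.smul_apply, smul_eq_mul, htA,
        hxy, hw₁y]
      push_cast
      ring
    · rw [map_add, map_add, map_smul, map_smul, LinearMap.add_apply, LinearMap.add_apply,
        LinearMap.smul_apply, LinearMap.smul_apply, hzβ, hw₁x, hB.self_eq_zero, smul_eq_mul,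
        smul_eq_mul, mul_zero, mul_zero, add_zero, add_zero]

end ReachLocal

/-! ### The theorem -/

/-- **Unimodular transitivity of the level-2 elementary moves, local hypotheses.**  Let `ℤΔ` be a
lattice on which the alternating form `B` is integral and `x, y ∈ ℤΔ` with `⟨x, y⟩ = 1`, and let
`Γ ≤ GL(V)` contain a move `v ↦ v + 2(⟨v,e⟩f + ⟨v,f⟩e)` for `e ∈ {x, y}` and all `f ∈ ℤΔ` with
`⟨e, f⟩ = 0`, and a move `T_a² : v ↦ v - 2⟨v,a⟩a` for `a ∈ {x, y, x + y}` (for a base pair of a skew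
vanishing lattice these lie in the monodromy group `Γ_Δ` without Janssen's Theorem 2.5).  Then every
`t ∈ x + 2ℤΔ` which is unimodular (`⟨t, y'⟩ = 1` for some `y' ∈ ℤΔ`) is `g x` for some `g ∈ Γ`.
Proof: coordinates `A = ⟨t, y⟩` (odd), `β = ⟨z, x⟩`; if `β ≠ 0`, `localTubeSpan_reach_of_ne_zero_local`;
if `β = 0` and `A = ±1`, the coprime case; otherwise one move `E_{y,w₁}²` makes `β = -⟨t, w₁⟩ ≠ 0`
(unimodularity is transported along the isometry).
[cite: Janssen1983, Thm. 2.9 (proof from Thm. 2.5)] -/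
theorem localTubeSpan_unimodularTransitivity_local (B : LinearMap.BilinForm ℚ V) (hB : B.IsAlt)
    (Δ : Set V) (hint : ∀ δ ∈ Δ, ∀ δ' ∈ Δ, ∃ n : ℤ, B δ δ' = n)
    (Γ : Subgroup (V →ₗ[ℚ] V)ˣ) {x y : V} (hx : x ∈ Submodule.span ℤ Δ)
    (hy : y ∈ Submodule.span ℤ Δ) (hxy : B x y = 1)
    (hpair : ∀ e ∈ ({x, y} : Set V), ∀ f ∈ Submodule.span ℤ Δ, B e f = 0 →
      ∃ g ∈ Γ, ∀ v : V, ((g : (V →ₗ[ℚ] V)ˣ) : V →ₗ[ℚ] V) v = v + (2 : ℚ) • (B v e • f + B v f • e))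
    (hsq : ∀ a ∈ ({x, y, x + y} : Set V), ∃ g ∈ Γ, ∀ v : V,
        ((g : (V →ₗ[ℚ] V)ˣ) : V →ₗ[ℚ] V) v = v - (2 : ℚ) • (B v a • a))
    {t : V} (ht : ∃ z ∈ Submodule.span ℤ Δ, t = x + (2 : ℚ) • z)
    (htu : ∃ y' ∈ Submodule.span ℤ Δ, B t y' = 1) :
    ∃ g ∈ Γ, ((g : (V →ₗ[ℚ] V)ˣ) : V →ₗ[ℚ] V) x = t := by
  obtain ⟨z, hz, ht⟩ := ht
  have hyx : B y x = -1 := by rw [← hB.neg_eq, hxy]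
  have htmem : t ∈ Submodule.span ℤ Δ := by
    rw [ht, show (2 : ℚ) • z = ((2 : ℤ) : ℚ) • z by norm_num]
    exact Submodule.add_mem _ hx (localTubeSpan_intCast_smul_mem Δ hz _)
  obtain ⟨A, htA⟩ := localTubeSpan_integral_span B Δ hint htmem hy
  obtain ⟨β, hzβ⟩ := localTubeSpan_integral_span B Δ hint hz hx
  by_cases hβ0 : β = 0
  swap
  · exact localTubeSpan_reach_of_ne_zero_local B Δ Γ hB hint hxy hpair hsq hx hy hz ht htA hzβ hβ0
      htu
  subst hβ0
  by_cases hunit : IsUnit A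
  · exact localTubeSpan_reach_of_isCoprime_local B Δ Γ hB hint hxy hpair hsq hx hy hz ht htA hzβ
      (isCoprime_zero_right.2 hunit)
  -- `β = 0`, `A ≠ ±1`: make `β ≠ 0` by one move `E_{y, w₁}²`
  obtain ⟨y', hy', hty'⟩ := htu
  obtain ⟨w₁, hw₁, hw₁x, hw₁y, hrel⟩ := localTubeSpan_partner_split B Δ hxy hB hint hx hy hy' hty'
  have htx : B t x = 0 := by
    rw [ht, map_add, map_smul, LinearMap.add_apply, LinearMap.smul_apply, hB.self_eq_zero, hzβ,
      Int.cast_zero, smul_zero, add_zero]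
  obtain ⟨u, hu⟩ := localTubeSpan_integral_span B Δ hint hy' hx
  obtain ⟨j, hj⟩ := localTubeSpan_integral_span B Δ hint htmem hw₁
  have hj0 : j ≠ 0 := by
    rintro rfl
    rw [hu, htA, htx, hj, Int.cast_zero, mul_zero, add_zero, add_zero] at hrel
    exact hunit (IsUnit.of_mul_eq_one (-u) (by exact_mod_cast (show (A : ℚ) * -u = 1 by
      rw [← hrel]; ring)))
  have hyw₁ : B y w₁ = 0 := by rw [← hB.neg_eq, hw₁y, neg_zero]
  obtain ⟨g, hg, hgf⟩ := hpair y (by simp) w₁ hw₁ hyw₁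
  refine localTubeSpan_reach_of_reach_apply Γ hg ?_
  refine localTubeSpan_reach_of_ne_zero_local B Δ Γ hB hint hxy hpair hsq hx hy
    (z := z + (A : ℚ) • w₁ + (j : ℚ) • y)
    (Submodule.add_mem _ (Submodule.add_mem _ hz (localTubeSpan_intCast_smul_mem Δ hw₁ _))
      (localTubeSpan_intCast_smul_mem Δ hy _)) ?_ (A := A) (β := -j) ?_ ?_ (neg_ne_zero.2 hj0) ?_
  · rw [hgf, htA, hj, ht]
    module
  · rw [hgf, htA, hj, map_add, map_smul, map_add, map_smul, map_smul, LinearMap.add_apply,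
      LinearMap.smul_apply, LinearMap.add_apply, LinearMap.smul_apply, LinearMap.smul_apply, htA,
      hw₁y, hB.self_eq_zero, smul_eq_mul, smul_eq_mul, smul_eq_mul, mul_zero, mul_zero, add_zero,
      mul_zero, add_zero]
  · simp only [map_add, map_smul, LinearMap.add_apply, LinearMap.smul_apply, hzβ, hw₁x, hyx,
      smul_eq_mul, Int.cast_zero, Int.cast_neg]
    ring
  · -- unimodularity is transported along the isometry `g`
    refine ⟨(g : V →ₗ[ℚ] V) y', localTubeSpan_pairMove_mem_span B Δ hint hy hw₁ _ hgf hy', ?_⟩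
    rw [localTubeSpan_pairMove_isometry B hB hyw₁ _ hgf, hty']

end Summit.HodgeConjecture.HodgeConjecture.Theorems

end
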